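import Literature.NumberTheory.PAdicHodge.AinfRamifiedWittFontaineLimit
import Literature.NumberTheory.PAdicHodge.AinfRamifiedWittFormalGroupPoints
import Literature.NumberTheory.PAdicHodge.LubinTateAinfTorsionLift
import HarnessLib

/-!
# Fontaine's element `x_t = lim Φⁿ(û_{kn}) ∈ A_inf(𝒪_F)` of a division tower of a Lubin–Tate-type polynomial
# `P = c·X + X^q` over `𝒪_D = W(k_F)[ϖ]` (general residue degree)

Topic `Literature/NumberTheory/PAdicHodge`; the residue-degree-`f` version (Eisenstein datum `D : EisensteinRootW F p hp` over
`W(k_F)`, topological ring `AinfRamWTop D`, discrete coefficient ring `EisensteinRootW.CoeffDisc D`) of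
`LubinTateAinfTorsionLift` — VERBATIM transcription; the generic polynomial `ltPoly' c q = c·X + X^q` / power series
`ltSeries` of that file are reused by import.  The endomorphism is `P(X) = c·X + X^q`, `c ∈ 𝒪_D`, `p ∣ q` (for `c = π`
and `q = #k_F = p^f` this is the special Lubin–Tate series of `(F, π)`), acting on `𝔫_𝒪 = θ_𝒪⁻¹(𝔪_{ℂ_F}) ⊂ A_inf(𝒪_F)`
and on `𝔪_{ℂ_F}`:

* `ltStep c q : a ↦ c·a + a^q` on `𝔫_𝒪`, `ltStepC` on `𝔪_{ℂ_F}`; `θ_𝒪 ∘ P = P ∘ θ_𝒪`, `σ ∘ P = P ∘ σ`;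
* one-step congruence `a ≡ b (mod 𝔦^{n+1}) ⇒ P(a) − P(b) ≡ c·(a − b) (mod 𝔦^{n+2})`, iterated; `Φ := Pᵏ` is contracting as
  soon as `cᵏ ∈ 𝔦` (`isContracting_ltStep_iterate`) — e.g. `c = ϖ`, `k = e`: `ϖ^e ∈ p·A_inf(𝒪_F)` (`algebraMap_varpiDisc_pow_mem_ideal`);
* for a division tower `t : ℕ → 𝔪_{ℂ_F}`, `P(t_{n+1}) = t_n`, and any lifts: **`ltTorsionLift t := lim_n Φⁿ(û_{kn})`** exists,
  is independent of the lifts, `θ_𝒪(x_t) = t_0`, shift relation `P(x_{t⁺}) = x_t`, transport under continuous maps commuting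
  with `P` (`map_ltTorsionLift`), and `Γ_F`-equivariance `σ x_t = x_{σt}` (`gal_ltTorsionLift`).

Definitions (reviewed): `AinfRamWTop.ltStep`, `.ltStepC`, `.ltStepCont`, `.ltLift`, `.ltTorsionLift`, `.ltGalLift`.  No named
facts, no instances, no `sorry`.

## References
* J.-M. Fontaine, *Le corps des périodes p-adiques*, Astérisque 223 (1994), Exp. II §1.2. [FontaineAsterisque223III]
* J.-P. Serre, *Local class field theory* (Cassels–Fröhlich Ch. VI) §3.2–§3.3. [CasselsFrohlichANT1967]
* P. Colmez, *Périodes des variétés abéliennes à multiplication complexe*, Ann. of Math. 138 (1993), §I.2. [Colmez1993]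
-/

noncomputable section

open Ideal Filter Topology Field WittVector MvPowerSeries ValuativeRel

namespace Literature.NumberTheory.PAdicHodge

open Literature.NumberTheory.GaloisRepresentations
open Literature.NumberTheory.GaloisRepresentations.IsNonarchimedeanLocalField
open Literature.NumberTheory.GaloisRepresentations.LubinTate

variable {F : Type} [Field F] [ValuativeRel F] [TopologicalSpace F] [IsNonarchimedeanLocalField F] [CharZero F]
  {p : ℕ} [Fact p.Prime] {hp : valuation F p < 1} {D : EisensteinRootW F p hp}

variable [Fact (¬ IsUnit (p : integerC F))] [IsAdicComplete (Ideal.span {(p : integerC F)}) (integerC F)]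
  {hθ : Function.Surjective (fontaineTheta (integerC F) p)} (c : EisensteinRootW.CoeffDisc D) {q : ℕ} (hq : q ≠ 0)

namespace AinfRamWTop

/-! ## §1 `P` on `𝔫_𝒪` and on `𝔪_{ℂ_F}`; compatibility with `θ_𝒪` and `Γ_F` -/

/-- **`P = c·X + X^q` on `𝔫_𝒪`.** [cite: CasselsFrohlichANT1967, Ch. VI §3.3] -/
def ltStep (a : (nilTheta D hθ).toIdeal) : (nilTheta D hθ).toIdeal :=
  evalPt₁ (nilTheta D hθ) (ltSeries c q) (constantCoeff_ltSeries c hq) a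

/-- **`P = c·X + X^q` on `𝔪_{ℂ_F}`** (through `𝒪_D → 𝒪_{ℂ_F}`). [cite: CasselsFrohlichANT1967, Ch. VI §3.3] -/
def ltStepC (t : (maxNilIdealC F).toIdeal) : (maxNilIdealC F).toIdeal :=
  evalPt₁ (maxNilIdealC F) (ltSeries c q) (constantCoeff_ltSeries c hq) t

/-- `P(a) = c·a + a^q` in `A_inf(𝒪)`. [cite: CasselsFrohlichANT1967, Ch. VI §3.3] -/
theorem coe_ltStep (a : (nilTheta D hθ).toIdeal) :
    ((ltStep c hq a : (nilTheta D hθ).toIdeal) : AinfRamWTop D) =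
      algebraMap (EisensteinRootW.CoeffDisc D) (AinfRamWTop D) c * a + (a : AinfRamWTop D) ^ q := by
  rw [ltStep]; exact (coe_evalPt₁_coe _ (ltPoly' c q) _ a).trans (aeval_ltPoly' c q _)

omit [Fact (¬ IsUnit (p : integerC F))] [IsAdicComplete (Ideal.span {(p : integerC F)}) (integerC F)] in
/-- `P(t) = c·t + t^q` in `𝒪_{ℂ_F}`. [cite: CasselsFrohlichANT1967, Ch. VI §3.3] -/
theorem coe_ltStepC (t : (maxNilIdealC F).toIdeal) :
    ((ltStepC c hq t : (maxNilIdealC F).toIdeal) : CBall F) =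
      algebraMap (EisensteinRootW.CoeffDisc D) (CBall F) c * t + (t : CBall F) ^ q := by
  rw [ltStepC]; exact (coe_evalPt₁_coe _ (ltPoly' c q) _ t).trans (aeval_ltPoly' c q _)

/-- **`θ_𝒪 ∘ P = P ∘ θ_𝒪`.** [cite: CasselsFrohlichANT1967, Ch. VI §3.2] -/
theorem theta_ltStep (a : (nilTheta D hθ).toIdeal) :
    theta D (ltStep c hq a : AinfRamWTop D) = (ltStepC c hq ⟨theta D a, theta_mem_maxNilIdealC a.2⟩ : CBall F) :=
  theta_evalPt (EisensteinRootW.theta_algebraMap_coeffDisc D) _ (constantCoeff_ltSeries c hq) (fun _ : Unit => a)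
    (fun _ : Unit => ⟨theta D a, theta_mem_maxNilIdealC a.2⟩) fun _ => rfl

/-- **`σ ∘ P = P ∘ σ`** on `𝔫_𝒪`. [cite: FontaineAsterisque223III, Exp. II §1.2] -/
theorem gal_ltStep (σ : absoluteGaloisGroup F) (a : (nilTheta D hθ).toIdeal) :
    gal D σ (ltStep c hq a : AinfRamWTop D) = (ltStep c hq ⟨gal D σ a, gal_mem_nilTheta σ a.2⟩ : AinfRamWTop D) :=
  gal_evalPt σ (EisensteinRootW.gal_algebraMap_coeffDisc D σ) _ (constantCoeff_ltSeries c hq) (fun _ : Unit => a)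
    (fun _ : Unit => ⟨gal D σ a, gal_mem_nilTheta σ a.2⟩) fun _ => rfl

/-- Iterates: `θ_𝒪 ∘ Pᵐ = Pᵐ ∘ θ_𝒪`. [cite: CasselsFrohlichANT1967, Ch. VI §3.2] -/
theorem theta_ltStep_iterate (m : ℕ) (a : (nilTheta D hθ).toIdeal) :
    theta D (((ltStep c hq)^[m] a : (nilTheta D hθ).toIdeal) : AinfRamWTop D) =
      (((ltStepC c hq)^[m] ⟨theta D a, theta_mem_maxNilIdealC a.2⟩ : (maxNilIdealC F).toIdeal) : CBall F) := by
  induction m generalizing a with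
  | zero => rfl
  | succ m ih =>
    rw [Function.iterate_succ_apply, Function.iterate_succ_apply, ih]
    congr 2
    exact Subtype.ext (theta_ltStep c hq a)

variable (q) in
/-- **`P` as a continuous self-map `x ↦ c·x + x^q` of the whole ring `A_inf(𝒪)`** (the global extension used in the
transport lemma `AinfRamWTop.map_flim`). [cite: FontaineAsterisque223III, Exp. II §1.2.2] -/
def ltStepCont (x : AinfRamWTop D) : AinfRamWTop D := algebraMap (EisensteinRootW.CoeffDisc D) (AinfRamWTop D) c * x + x ^ q

omit [IsAdicComplete (Ideal.span {(p : integerC F)}) (integerC F)] in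
/-- `x ↦ c·x + x^q` is continuous. [cite: FontaineAsterisque223III, Exp. II §1.3.1] -/
theorem continuous_ltStepCont : Continuous (ltStepCont c q : AinfRamWTop D → AinfRamWTop D) :=
  (continuous_const.mul continuous_id).add (continuous_id.pow q)

/-- `ltStepCont` restricts to `ltStep` on `𝔫_𝒪`. [cite: CasselsFrohlichANT1967, Ch. VI §3.3] -/
theorem coe_ltStep_eq_ltStepCont (a : (nilTheta D hθ).toIdeal) :
    ((ltStep c hq a : (nilTheta D hθ).toIdeal) : AinfRamWTop D) = ltStepCont c q (a : AinfRamWTop D) :=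
  coe_ltStep c hq a

/-! ## §2 The congruences `P(a) − P(b) ≡ c(a − b)`, `Pᵏ(a) − Pᵏ(b) ≡ cᵏ(a − b)`; `Pᵏ` is contracting -/

variable {c hq}

omit [IsAdicComplete (Ideal.span {(p : integerC F)}) (integerC F)] in
/-- `q ∈ 𝔦 = (p, ω)` when `p ∣ q`. [cite: FontaineAsterisque223III, Exp. II §1.3.1] -/
theorem natCast_mem_ideal_of_dvd (hpq : p ∣ q) : ((q : ℕ) : AinfRamWTop D) ∈ (WithIdeal.i : Ideal (AinfRamWTop D)) := by
  obtain ⟨m, rfl⟩ := hpq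
  rw [Nat.cast_mul]
  exact Ideal.mul_mem_right _ _ (natCast_mem_ideal D)

/-- **One-step congruence**: `a ≡ b (mod 𝔦^{n+1}) ⇒ P(a) − P(b) − c(a − b) = a^q − b^q ∈ 𝔦^{n+2}` (`q ∈ 𝔦`).
[cite: SilvermanAEC2009, IV.4.4] [cite: CasselsFrohlichANT1967, Ch. VI §3.3] -/
theorem ltStep_sub_sub_mem (hpq : p ∣ q) {n : ℕ} {a b : (nilTheta D hθ).toIdeal}
    (h : (a : AinfRamWTop D) - b ∈ (WithIdeal.i ^ (n + 1) : Ideal (AinfRamWTop D))) :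
    ((ltStep c hq a : (nilTheta D hθ).toIdeal) : AinfRamWTop D) - ltStep c hq b -
        algebraMap (EisensteinRootW.CoeffDisc D) (AinfRamWTop D) c * ((a : AinfRamWTop D) - b) ∈
      (WithIdeal.i ^ (n + 2) : Ideal (AinfRamWTop D)) := by
  have hq' := pow_sub_pow_mem_pow_succ (Nat.pos_of_ne_zero hq) (natCast_mem_ideal_of_dvd hpq) h
  rw [coe_ltStep, coe_ltStep]
  convert hq' using 1
  ring

/-- **Iterated congruence**: `a ≡ b (mod 𝔦^{n+1}) ⇒ Pᵏ(a) − Pᵏ(b) − cᵏ(a − b) ∈ 𝔦^{n+2}`.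
[cite: SilvermanAEC2009, IV.4.4] [cite: FontaineAsterisque223III, Exp. II §1.2.1] -/
theorem ltStep_iterate_sub_sub_mem (hpq : p ∣ q) {n : ℕ} (k : ℕ) :
    ∀ {a b : (nilTheta D hθ).toIdeal}, (a : AinfRamWTop D) - b ∈ (WithIdeal.i ^ (n + 1) : Ideal (AinfRamWTop D)) →
      (((ltStep c hq)^[k] a : (nilTheta D hθ).toIdeal) : AinfRamWTop D) - ((ltStep c hq)^[k] b : (nilTheta D hθ).toIdeal) -
          algebraMap (EisensteinRootW.CoeffDisc D) (AinfRamWTop D) c ^ k * ((a : AinfRamWTop D) - b) ∈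
        (WithIdeal.i ^ (n + 2) : Ideal (AinfRamWTop D)) := by
  induction k with
  | zero => intro a b _; simp
  | succ k ih =>
    intro a b h
    set γ := algebraMap (EisensteinRootW.CoeffDisc D) (AinfRamWTop D) c with hγ
    have hk := ih h
    -- `Pᵏ a ≡ Pᵏ b (mod 𝔦^{n+1})`
    have hAB : (((ltStep c hq)^[k] a : (nilTheta D hθ).toIdeal) : AinfRamWTop D) - ((ltStep c hq)^[k] b : (nilTheta D hθ).toIdeal) ∈
        (WithIdeal.i ^ (n + 1) : Ideal (AinfRamWTop D)) := by
      have h1 : γ ^ k * ((a : AinfRamWTop D) - b) ∈ (WithIdeal.i ^ (n + 1) : Ideal (AinfRamWTop D)) := Ideal.mul_mem_left _ _ h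
      have h2 := Ideal.pow_le_pow_right (I := (WithIdeal.i : Ideal (AinfRamWTop D))) (Nat.le_succ (n + 1)) hk
      have := Submodule.add_mem _ h2 h1
      simpa using this
    have hstep := ltStep_sub_sub_mem (c := c) (hq := hq) hpq hAB
    rw [Function.iterate_succ_apply', Function.iterate_succ_apply']
    have hc : γ * ((((ltStep c hq)^[k] a : (nilTheta D hθ).toIdeal) : AinfRamWTop D) - ((ltStep c hq)^[k] b : (nilTheta D hθ).toIdeal)) -
        γ ^ (k + 1) * ((a : AinfRamWTop D) - b) ∈ (WithIdeal.i ^ (n + 2) : Ideal (AinfRamWTop D)) := by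
      have := Ideal.mul_mem_left _ γ hk
      convert this using 1
      ring
    have := Submodule.add_mem _ hstep hc
    convert this using 1
    ring

/-- **`Φ = Pᵏ` is contracting on `𝔫_𝒪` as soon as `cᵏ ∈ 𝔦`** (e.g. `c = ϖ`, `k = e`).
[cite: FontaineAsterisque223III, Exp. II §1.2.1] [cite: SilvermanAEC2009, IV.4.4] -/
theorem isContracting_ltStep_iterate (hpq : p ∣ q) {k : ℕ}
    (hck : algebraMap (EisensteinRootW.CoeffDisc D) (AinfRamWTop D) c ^ k ∈ (WithIdeal.i : Ideal (AinfRamWTop D))) :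
    IsContracting hθ ((ltStep c hq)^[k]) := by
  intro n a b h
  have h1 := ltStep_iterate_sub_sub_mem (c := c) (hq := hq) hpq k h
  have h2 : algebraMap (EisensteinRootW.CoeffDisc D) (AinfRamWTop D) c ^ k * ((a : AinfRamWTop D) - b) ∈
      (WithIdeal.i ^ (n + 2) : Ideal (AinfRamWTop D)) := by
    rw [show n + 2 = 1 + (n + 1) by ring, pow_add, pow_one]
    exact Ideal.mul_mem_mul hck h
  have := Submodule.add_mem _ h1 h2
  simpa using this

/-- **`ϖ^e ∈ 𝔦`**: the hypothesis of `isContracting_ltStep_iterate` for `c = ϖ ∈ 𝒪_D`, `k = e` (Eisenstein: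
`ϖ^e ∈ p·A_inf(𝒪)`, tree `AinfRamW.varpi_pow_mem_span_natCast`). [cite: SerreLocalFields1979, Ch. I §6 Prop. 17] -/
theorem algebraMap_varpiDisc_pow_mem_ideal :
    algebraMap (EisensteinRootW.CoeffDisc D) (AinfRamWTop D) (EisensteinRootW.CoeffDisc.of D (AdjoinRoot.root D.poly)) ^ D.deg ∈
      (WithIdeal.i : Ideal (AinfRamWTop D)) := by
  rw [EisensteinRootW.algebraMap_coeffDisc_ainfRamTop, AinfRamW.coeffHom_root, ← map_pow]
  exact map_idealPXi_le D (Ideal.mem_map_of_mem _ (AinfRamW.varpi_pow_mem_idealPXi D))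

/-! ## §3 Division towers of `P` in `𝔪_{ℂ_F}` and their lifts -/

omit [Fact (¬ IsUnit (p : integerC F))] [IsAdicComplete (Ideal.span {(p : integerC F)}) (integerC F)] in
/-- `Pʲ t_{m+j} = t_m` along a division tower. [cite: CasselsFrohlichANT1967, Ch. VI §3.3] -/
theorem ltStepC_iterate_eq {t : ℕ → (maxNilIdealC F).toIdeal} (htp : ∀ n, ltStepC c hq (t (n + 1)) = t n) (m : ℕ) :
    ∀ j : ℕ, (ltStepC c hq)^[j] (t (m + j)) = t m
  | 0 => rfl
  | j + 1 => by
    rw [Function.iterate_succ_apply, ← Nat.add_assoc, htp, ltStepC_iterate_eq htp m j]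

omit [Fact (¬ IsUnit (p : integerC F))] [IsAdicComplete (Ideal.span {(p : integerC F)}) (integerC F)] in
/-- The shifted tower `t⁺ₙ = t_{n+i}` is again a division tower. [cite: CasselsFrohlichANT1967, Ch. VI §3.3] -/
theorem ltStepC_shift {t : ℕ → (maxNilIdealC F).toIdeal} (htp : ∀ n, ltStepC c hq (t (n + 1)) = t n) (i n : ℕ) :
    ltStepC c hq ((fun m => t (m + i)) (n + 1)) = (fun m => t (m + i)) n := by
  simp only [Nat.add_right_comm n 1 i, htp]

/-- Lifts `ûₙ` of the `kn`-th layers of a division tower are `Φ = Pᵏ`-compatible: `Φ û_{n+1} ≡ ûₙ (mod 𝔦)`.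
[cite: FontaineAsterisque223III, Exp. II §1.2.2] -/
theorem ltStep_iterate_lift_sub_mem {k : ℕ} {t : ℕ → (maxNilIdealC F).toIdeal} (htp : ∀ n, ltStepC c hq (t (n + 1)) = t n)
    {u : ℕ → (nilTheta D hθ).toIdeal} (hu : ∀ n, theta D (u n : AinfRamWTop D) = t (k * n)) (n : ℕ) :
    (((ltStep c hq)^[k] (u (n + 1)) : (nilTheta D hθ).toIdeal) : AinfRamWTop D) - u n ∈ (WithIdeal.i : Ideal (AinfRamWTop D)) := by
  refine sub_mem_ideal_of_theta_eq ?_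
  rw [theta_ltStep_iterate, hu n]
  have h : (⟨theta D (u (n + 1) : AinfRamWTop D), theta_mem_maxNilIdealC (u (n + 1)).2⟩ : (maxNilIdealC F).toIdeal) =
      t (k * n + k) :=
    Subtype.ext (show theta D (u (n + 1) : AinfRamWTop D) = (t (k * n + k) : CBall F) by rw [hu (n + 1), Nat.mul_succ])
  rw [h, ltStepC_iterate_eq htp]

/-- `θ_𝒪(Φⁿ ûₙ) = P^{kn} t_{kn} = t₀`. [cite: FontaineAsterisque223III, Exp. II §1.2.2] -/
theorem theta_ltApprox_eq {k : ℕ} {t : ℕ → (maxNilIdealC F).toIdeal} (htp : ∀ n, ltStepC c hq (t (n + 1)) = t n)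
    {u : ℕ → (nilTheta D hθ).toIdeal} (hu : ∀ n, theta D (u n : AinfRamWTop D) = t (k * n)) (n : ℕ) :
    theta D (approx ((ltStep c hq)^[k]) u n) = t 0 := by
  rw [approx_def, ← Function.iterate_mul, theta_ltStep_iterate]
  have h : (⟨theta D (u n : AinfRamWTop D), theta_mem_maxNilIdealC (u n).2⟩ : (maxNilIdealC F).toIdeal) = t (0 + k * n) :=
    Subtype.ext (by rw [zero_add]; exact hu n)
  rw [h, ltStepC_iterate_eq htp 0 (k * n)]

/-! ## §4 Fontaine's element `x_t` of a division tower -/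

variable (D) in
/-- A choice of lifts `ûₙ ∈ 𝔫_𝒪` of the points `tₙ ∈ 𝔪_{ℂ_F}` (`θ_𝒪` is onto). [cite: FontaineAsterisque223III, Exp. II §1.2.2] -/
def ltLift (hθ : Function.Surjective (fontaineTheta (integerC F) p)) (t : ℕ → (maxNilIdealC F).toIdeal) (n : ℕ) :
    (nilTheta D hθ).toIdeal :=
  Classical.choose (exists_theta_eq (hθ := hθ) (t n))

/-- The chosen lifts lift. [cite: FontaineAsterisque223III, Exp. II §1.2.2] -/
theorem theta_ltLift (t : ℕ → (maxNilIdealC F).toIdeal) (n : ℕ) : theta D (ltLift D hθ t n : AinfRamWTop D) = t n :=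
  Classical.choose_spec (exists_theta_eq (hθ := hθ) (t n))

variable (c hq)

/-- **Fontaine's element `x_t = lim_n Φⁿ(û_{kn}) ∈ A_inf(𝒪)`** (`Φ = Pᵏ`) of a division tower `t` of `P = c·X + X^q`
(for the chosen lifts of the layers `t_{kn}`; independent of them by `ltTorsionLift_eq_flim`).
[cite: FontaineAsterisque223III, Exp. II §1.2.2] [cite: Colmez1993, §I.2] -/
def ltTorsionLift (hpq : p ∣ q) {k : ℕ}
    (hck : algebraMap (EisensteinRootW.CoeffDisc D) (AinfRamWTop D) c ^ k ∈ (WithIdeal.i : Ideal (AinfRamWTop D)))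
    (hθ : Function.Surjective (fontaineTheta (integerC F) p)) (t : ℕ → (maxNilIdealC F).toIdeal)
    (htp : ∀ n, ltStepC c hq (t (n + 1)) = t n) : AinfRamWTop D :=
  flim (isContracting_ltStep_iterate (hθ := hθ) hpq hck) (fun n => ltLift D hθ t (k * n))
    (ltStep_iterate_lift_sub_mem htp fun n => theta_ltLift t (k * n))

variable {c hq} (hpq : p ∣ q) {k : ℕ}
  (hck : algebraMap (EisensteinRootW.CoeffDisc D) (AinfRamWTop D) c ^ k ∈ (WithIdeal.i : Ideal (AinfRamWTop D)))

/-- **Independence of the lifts**: for ANY lifts `uₙ` of the `t_{kn}`, `lim Φⁿ(uₙ) = x_t`.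
[cite: FontaineAsterisque223III, Exp. II §1.2.2] -/
theorem ltTorsionLift_eq_flim {t : ℕ → (maxNilIdealC F).toIdeal} (htp : ∀ n, ltStepC c hq (t (n + 1)) = t n)
    {u : ℕ → (nilTheta D hθ).toIdeal} (hu : ∀ n, theta D (u n : AinfRamWTop D) = t (k * n)) :
    ltTorsionLift c hq hpq hck hθ t htp =
      flim (isContracting_ltStep_iterate (hθ := hθ) hpq hck) u (ltStep_iterate_lift_sub_mem htp hu) :=
  flim_congr _ _ _ fun n => sub_mem_ideal_of_theta_eq (by rw [theta_ltLift, hu])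

/-- The approximants `Φⁿ(uₙ)` converge to `x_t`, for any lifts. [cite: FontaineAsterisque223III, Exp. II §1.2.2] -/
theorem tendsto_ltTorsionLift {t : ℕ → (maxNilIdealC F).toIdeal} (htp : ∀ n, ltStepC c hq (t (n + 1)) = t n)
    {u : ℕ → (nilTheta D hθ).toIdeal} (hu : ∀ n, theta D (u n : AinfRamWTop D) = t (k * n)) :
    Tendsto (approx ((ltStep c hq)^[k]) u) atTop (𝓝 (ltTorsionLift c hq hpq hck hθ t htp)) := by
  rw [ltTorsionLift_eq_flim hpq hck htp hu]
  exact tendsto_approx_flim _ _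

/-- **`θ_𝒪(x_t) = t₀`**; in particular `x_t ∈ ker θ_𝒪 = ω A_inf(𝒪)` when `t₀ = 0`.
[cite: FontaineAsterisque223III, Exp. II §1.2.2] -/
theorem theta_ltTorsionLift {t : ℕ → (maxNilIdealC F).toIdeal} (htp : ∀ n, ltStepC c hq (t (n + 1)) = t n) :
    theta D (ltTorsionLift c hq hpq hck hθ t htp) = t 0 :=
  theta_flim_eq_of_forall _ _ (theta_ltApprox_eq htp fun n => theta_ltLift t (k * n))

/-- `x_t ∈ 𝔫_𝒪`. [cite: FontaineAsterisque223III, Exp. II §1.2.2] -/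
theorem ltTorsionLift_mem_nilTheta {t : ℕ → (maxNilIdealC F).toIdeal} (htp : ∀ n, ltStepC c hq (t (n + 1)) = t n) :
    ltTorsionLift c hq hpq hck hθ t htp ∈ (nilTheta D hθ).toIdeal :=
  flim_mem_nilTheta _ _

/-- **Transport lemma**: a continuous self-map `s` of `A_inf(𝒪)` preserving `𝔫_𝒪` and commuting with `P` there, and
covering through `θ_𝒪` a self-map `sC` of `𝔪_{ℂ_F}` that maps the division tower `t` to a division tower `t'`,
satisfies `s(x_t) = x_{t'}` (used for `σ ∈ Γ_F`, for the endomorphisms `[a]_f`, and for Teichmüller multiplications).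
[cite: FontaineAsterisque223III, Exp. II §1.2.2] [cite: Colmez1993, §I.2] -/
theorem map_ltTorsionLift {s : AinfRamWTop D → AinfRamWTop D} (hs : Continuous s)
    (s𝔫 : (nilTheta D hθ).toIdeal → (nilTheta D hθ).toIdeal)
    (hs𝔫 : ∀ a : (nilTheta D hθ).toIdeal, ((s𝔫 a : (nilTheta D hθ).toIdeal) : AinfRamWTop D) = s a)
    (hsP : ∀ a : (nilTheta D hθ).toIdeal, s𝔫 (ltStep c hq a) = ltStep c hq (s𝔫 a))
    {t t' : ℕ → (maxNilIdealC F).toIdeal} (htp : ∀ n, ltStepC c hq (t (n + 1)) = t n)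
    (htp' : ∀ n, ltStepC c hq (t' (n + 1)) = t' n)
    (hst : ∀ n, theta D (s𝔫 (ltLift D hθ t (k * n)) : AinfRamWTop D) = t' (k * n)) :
    s (ltTorsionLift c hq hpq hck hθ t htp) = ltTorsionLift c hq hpq hck hθ t' htp' := by
  have hsΦ : ∀ a : (nilTheta D hθ).toIdeal, s𝔫 ((ltStep c hq)^[k] a) = (ltStep c hq)^[k] (s𝔫 a) :=
    Function.Commute.iterate_right (show Function.Commute s𝔫 (ltStep c hq) from hsP) k
  rw [ltTorsionLift, ltTorsionLift_eq_flim hpq hck htp' hst]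
  exact map_flim (isContracting_ltStep_iterate (hθ := hθ) hpq hck) hs s𝔫 hs𝔫 hsΦ (u := fun n => ltLift D hθ t (k * n))
    (su := fun n => s𝔫 (ltLift D hθ t (k * n))) (fun _ => rfl) _ _

/-- **The shift relation `P(x_{t⁺}) = x_t`** for `t⁺ₙ = t_{n+1}` (`P` is continuous, commutes with `Φ = Pᵏ`, and maps
lifts of `t_{kn+1}` to lifts of `t_{kn}`). [cite: Colmez1993, §I.2] [cite: FontaineAsterisque223III, Exp. II §1.2.2] -/
theorem ltStep_ltTorsionLift_shift {t : ℕ → (maxNilIdealC F).toIdeal} (htp : ∀ n, ltStepC c hq (t (n + 1)) = t n) :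
    ltStepCont c q (ltTorsionLift c hq hpq hck hθ (fun m => t (m + 1)) (ltStepC_shift htp 1)) =
      ltTorsionLift c hq hpq hck hθ t htp := by
  refine map_ltTorsionLift (t := fun m => t (m + 1)) (t' := t) hpq hck (continuous_ltStepCont c) (ltStep c hq)
    (coe_ltStep_eq_ltStepCont c hq) (fun _ => rfl) (ltStepC_shift htp 1) htp fun n => ?_
  rw [theta_ltStep, ← htp (k * n)]
  congr 2
  exact Subtype.ext (theta_ltLift _ _)

/-- **`x_t = c·x_{t⁺} + x_{t⁺}^q`.** [cite: Colmez1993, §I.2] -/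
theorem coe_ltTorsionLift_eq_shift {t : ℕ → (maxNilIdealC F).toIdeal} (htp : ∀ n, ltStepC c hq (t (n + 1)) = t n) :
    ltTorsionLift c hq hpq hck hθ t htp =
      algebraMap (EisensteinRootW.CoeffDisc D) (AinfRamWTop D) c *
          ltTorsionLift c hq hpq hck hθ (fun m => t (m + 1)) (ltStepC_shift htp 1) +
        ltTorsionLift c hq hpq hck hθ (fun m => t (m + 1)) (ltStepC_shift htp 1) ^ q := by
  rw [← ltStep_ltTorsionLift_shift hpq hck htp, ltStepCont]

/-- `θ_𝒪(x_{t⁺}) = t₁`. [cite: Colmez1993, §I.2] -/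
theorem theta_ltTorsionLift_shift {t : ℕ → (maxNilIdealC F).toIdeal} (htp : ∀ n, ltStepC c hq (t (n + 1)) = t n) :
    theta D (ltTorsionLift c hq hpq hck hθ (fun m => t (m + 1)) (ltStepC_shift htp 1)) = t 1 := by
  rw [theta_ltTorsionLift]

/-! ## §5 `Γ_F`-equivariance: `σ x_t = x_{σt}` -/

variable (D) in
/-- The `σ`-translate of the chosen lifts. [cite: FontaineAsterisque223III, Exp. II §1.2] -/
def ltGalLift (hθ : Function.Surjective (fontaineTheta (integerC F) p)) (σ : absoluteGaloisGroup F)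
    (t : ℕ → (maxNilIdealC F).toIdeal) (n : ℕ) : (nilTheta D hθ).toIdeal :=
  ⟨gal D σ (ltLift D hθ t n), gal_mem_nilTheta σ (ltLift D hθ t n).2⟩

/-- `θ_𝒪(σ ûₙ) = σ tₙ`. [cite: FontaineAsterisque223III, Exp. II §1.2] -/
theorem theta_ltGalLift (σ : absoluteGaloisGroup F) (t : ℕ → (maxNilIdealC F).toIdeal) (n : ℕ) :
    theta D (ltGalLift D hθ σ t n : AinfRamWTop D) = AinfTop.galSeq F σ t n := by
  apply Subtype.ext
  change ((theta D (gal D σ (ltLift D hθ t n : AinfRamWTop D)) : CBall F) : CompletedAlgClosure F) = _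
  rw [coe_theta_gal, theta_ltLift, AinfTop.coe_galSeq, coe_galCBall]

/-- **`σ` maps division towers to division towers**: `P(σ t_{n+1}) = σ t_n` (transport through `θ_𝒪` and lifts).
[cite: FontaineAsterisque223III, Exp. II §1.2] -/
theorem ltStepC_galSeq (hθ' : Function.Surjective (fontaineTheta (integerC F) p)) (σ : absoluteGaloisGroup F)
    {t : ℕ → (maxNilIdealC F).toIdeal} (htp : ∀ n, ltStepC c hq (t (n + 1)) = t n) (n : ℕ) :
    ltStepC c hq (AinfTop.galSeq F σ t (n + 1)) = AinfTop.galSeq F σ t n := by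
  have h1 : theta D (gal D σ (ltStep c hq (ltLift D hθ' t (n + 1)) : AinfRamWTop D)) =
      (ltStepC c hq (AinfTop.galSeq F σ t (n + 1)) : CBall F) := by
    rw [gal_ltStep, theta_ltStep]
    congr 2
    exact Subtype.ext (theta_ltGalLift (D := D) (hθ := hθ') σ t (n + 1))
  have h2 : theta D (gal D σ (ltStep c hq (ltLift D hθ' t (n + 1)) : AinfRamWTop D)) = (AinfTop.galSeq F σ t n : CBall F) := by
    apply Subtype.ext
    rw [coe_theta_gal, theta_ltStep, AinfTop.coe_galSeq, coe_galCBall]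
    have h : (⟨theta D (ltLift D hθ' t (n + 1) : AinfRamWTop D), theta_mem_maxNilIdealC (ltLift D hθ' t (n + 1)).2⟩ :
        (maxNilIdealC F).toIdeal) = t (n + 1) := Subtype.ext (theta_ltLift t (n + 1))
    rw [h, htp]
  exact Subtype.ext (h1.symm.trans h2)

/-- **`Γ_F`-equivariance of Fontaine's element: `σ x_t = x_{σt}`.** [cite: FontaineAsterisque223III, Exp. II §1.2]
[cite: Colmez1993, §I.2] -/
theorem gal_ltTorsionLift (σ : absoluteGaloisGroup F) {t : ℕ → (maxNilIdealC F).toIdeal}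
    (htp : ∀ n, ltStepC c hq (t (n + 1)) = t n) :
    gal D σ (ltTorsionLift c hq hpq hck hθ t htp) =
      ltTorsionLift c hq hpq hck hθ (AinfTop.galSeq F σ t) (ltStepC_galSeq hθ σ htp) :=
  map_ltTorsionLift hpq hck (continuous_gal σ) (fun a => ⟨gal D σ a, gal_mem_nilTheta σ a.2⟩) (fun _ => rfl)
    (fun a => Subtype.ext (gal_ltStep c hq σ a)) htp _ fun n => theta_ltGalLift σ t (k * n)

end AinfRamWTop

end Literature.NumberTheory.PAdicHodge

end
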